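import Literature.AnabelianGeometry.AbsoluteAnabelian.UnitKummerNaturalityColimit
import Literature.AnabelianGeometry.AbsoluteAnabelian.MonoidKummerLimitNaturality
import HarnessLib

/-!
# [AbsTopIII] Prop 3.3 (i): naturality of the COLIMIT unit Kummer maps of the model `TLG`/`TCG`-pairs in the
# group-structured direct limit — the induced maps `pullLim` / `pushLim` (abc-iut-L4-t2's colimit API, consumed by name)

S. Mochizuki, *Topics in absolute anabelian geometry III*, §3, Prop. 3.3 (i) p. 73 (bib key `MochizukiAbsTopIII2015`): the
Kummer maps "`M → lim→_J H¹(J, μ_Ẑ(M))`" are functorial relative to `C^MLF_T`.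

abc-iut cell, layer L4, row «Prop33i-NATURALITY» / «COLIMIT-PACKAGING», upgrade (seat abc-iut-w4-d009 gen 4; abc-iut-L4-lead
RULING #6f: «`ModelMLFGaloisData.pullLim_kummerClass` generic colimit lemma — w4-d009 consumes BY NAME»).  PROOF-ONLY, 0 defs.
`UnitKummerNaturalityColimit.lean` (p430876) packaged the colimit naturality at REPRESENTATIVES, the bare quotient
`ContCohomologyData.H1Lim` carrying no functoriality.  abc-iut-L4-t2's `MonoidKummerLimitNaturality.lean` (p431662) has since
BUILT, over the shared model cohomology data `ModelMLFGaloisData.kummerCohomology` (= the `coh` of the `TLG`/`TCG` unit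
theories as well), the comparison system `resCohomology` and the induced homomorphisms of group-structured direct limits
`pullLim : lim→_{J₂} H¹(J₂, Λ(k̄₂ˣ)) →+ lim→_{J₁} H¹(J₁, res Λ(k̄₂ˣ))`, `pushLim : lim→_{J₁} H¹(J₁, Λ(k̄₁ˣ)) →+ …`, with the generic
`pullLim_kummerClass`.  Hence the genuine colimit statement for the unit theories:

* `GaloisMonoidPair.Hom.tlg_toGrp_kummerLim_natural` — for ANY Def. 3.1 (ii) morphism `φ` of the model `TLG`-pairs and every
  `m ∈ k̄₁^×`: `pullLim (κ^lim₂(φ_M m)) = pushLim (κ^lim₁(m))`, the `κ^lim` being the images of abc-iut-L4-t2's `kummerLim` in the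
  group-structured direct limit (`toGrp`, a bijection: `ContCohomologyData.toGrp_bijective`);
* `GaloisMonoidPair.Hom.tcg_toGrp_kummerLim_natural` — the same for the model `TCG`-pairs and a morphism given with a
  `φ_Π`-equivariant `k̄ˣ`-extension `Φ` of its unit map (abc-iut-L4-t2's colimit maps live over the `Λ(k̄ˣ)` data; the
  intrinsic `Λ((𝒪^×)ˣ)` classes reach them through the comparison squares of p430251/p431773, whose legs are isomorphisms).

HONEST FRAMING: classical Kummer theory at OUR model objects; nothing here bears on [IUTchIII] Cor. 3.12.
-/

noncomputable section

open scoped nonZeroDivisors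

namespace Literature.AnabelianGeometry.AbsoluteAnabelian

open Literature.AnabelianGeometry.EtaleTheta (EquivariantMorphism kummerClass invariants)

namespace GaloisMonoidPair.Hom

variable {C₁ C₂ : MLFClosure.{0}} {D₁ : ModelMLFGaloisData C₁.k C₁.K} {D₂ : ModelMLFGaloisData C₂.k C₂.K}

/-- **Prop 3.3 (i), COLIMIT form, model `TLG`-pairs, group-structured direct limit.**  For a Def. 3.1 (ii) morphism
`φ = (φ_Π, φ_M) : (Π_{k₁} ↷ k̄₁^×) → (Π_{k₂} ↷ k̄₂^×)` of the model `TLG`-pairs and `m ∈ k̄₁^×`, the colimit unit Kummer classes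
`κ^lim(m) = toGrp (kummerLim m) ∈ lim→_J H¹(J, Λ(k̄ˣ))` of abc-iut-L4-t2's `unitKummerTheoryTLG` satisfy
`pullLim (κ^lim₂(φ_M m)) = pushLim (κ^lim₁(m))` in `lim→_{J} H¹(J, res_{φ_Π} Λ(k̄₂ˣ))` (abc-iut-L4-t2's `pullLim` / `pushLim` /
`pullLim_kummerClass`, p431662, BY NAME). [cite: MochizukiAbsTopIII2015, Proposition 3.3 (i) p.73] -/
theorem tlg_toGrp_kummerLim_natural (φ : GaloisMonoidPair.Hom D₁.tlgPair D₂.tlgPair) (m : D₁.tlgPair.M) :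
    ModelMLFGaloisData.pullLim (⟨φ.homPi, nonZeroDivisorsEquivUnits.toMonoidHom.comp
          (φ.homM.comp (nonZeroDivisorsEquivUnits (G₀ := C₁.K)).symm.toMonoidHom),
        ModelMLFGaloisData.tlgHom_unitsMap_smul C₁ C₂ D₁ D₂ φ⟩ : EquivariantMorphism D₁.Pi (C₁.K)ˣ D₂.Pi (C₂.K)ˣ) φ.continuous_homPi
        ((D₂.unitKummerTheoryTLG C₂).coh.toGrp ((D₂.unitKummerTheoryTLG C₂).kummerLim (φ.homM m))) =
      ModelMLFGaloisData.pushLim (⟨φ.homPi, nonZeroDivisorsEquivUnits.toMonoidHom.comp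
          (φ.homM.comp (nonZeroDivisorsEquivUnits (G₀ := C₁.K)).symm.toMonoidHom),
        ModelMLFGaloisData.tlgHom_unitsMap_smul C₁ C₂ D₁ D₂ φ⟩ : EquivariantMorphism D₁.Pi (C₁.K)ˣ D₂.Pi (C₂.K)ˣ)
        ((D₁.unitKummerTheoryTLG C₁).coh.toGrp ((D₁.unitKummerTheoryTLG C₁).kummerLim m)) := by
  have hm₁ : ∀ h : D₁.tlgStabilizerOpen C₁ m, (h : D₁.tlgPair.Pi) • m = m :=
    fun h => MulAction.mem_stabilizer_iff.mp h.2
  have hm₂ : ∀ h : D₂.tlgStabilizerOpen C₂ (φ.homM m), (h : D₂.tlgPair.Pi) • φ.homM m = φ.homM m :=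
    fun h => MulAction.mem_stabilizer_iff.mp h.2
  rw [D₂.unitKummerTheoryTLG_toGrp_kummerLim C₂ (φ.homM m) _ hm₂, D₁.unitKummerTheoryTLG_toGrp_kummerLim C₁ m _ hm₁,
    ModelMLFGaloisData.unitKummerTheoryTLG_kummer, ModelMLFGaloisData.unitKummerTheoryTLG_kummer]
  refine ModelMLFGaloisData.pullLim_kummerClass _ _ _ _ _ _ ?_
  change nonZeroDivisorsEquivUnits (φ.homM ((nonZeroDivisorsEquivUnits (G₀ := C₁.K)).symm
      (ModelMLFGaloisData.tlgToUnit C₁ m))) = ModelMLFGaloisData.tlgToUnit C₂ (φ.homM m)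
  rw [ModelMLFGaloisData.tlgToUnit_eq_nonZeroDivisorsEquivUnits, ModelMLFGaloisData.tlgToUnit_eq_nonZeroDivisorsEquivUnits,
    MulEquiv.symm_apply_apply]

/-- **Prop 3.3 (i), COLIMIT form, model `TCG`-pairs, group-structured direct limit** (morphism given with a
`φ_Π`-equivariant `k̄ˣ`-extension `Φ` of its unit map — bookkeeping datum over abc-iut-L4-t2's `Λ(k̄ˣ)` colimit data): for
`m ∈ 𝒪_{k̄₁}^×`, `pullLim (κ^lim₂(φ_M m)) = pushLim (κ^lim₁(m))` for the colimit classes of `unitKummerTheoryTCG`.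
[cite: MochizukiAbsTopIII2015, Proposition 3.3 (i) p.73] -/
theorem tcg_toGrp_kummerLim_natural (φ : GaloisMonoidPair.Hom D₁.tcgPair D₂.tcgPair) (Φ : (C₁.K)ˣ →* (C₂.K)ˣ)
    (hΦ : ∀ x : unitSubmonoid C₁.k C₁.K, Φ (ModelMLFGaloisData.tcgToUnit C₁ x) = ModelMLFGaloisData.tcgToUnit C₂ (φ.homM x))
    (hΦs : ∀ (g : D₁.Pi) (u : (C₁.K)ˣ), Φ (g • u) = φ.homPi g • Φ u) (m : D₁.tcgPair.M) :
    ModelMLFGaloisData.pullLim (⟨φ.homPi, Φ, hΦs⟩ : EquivariantMorphism D₁.Pi (C₁.K)ˣ D₂.Pi (C₂.K)ˣ) φ.continuous_homPi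
        ((D₂.unitKummerTheoryTCG C₂).coh.toGrp ((D₂.unitKummerTheoryTCG C₂).kummerLim (φ.homM m))) =
      ModelMLFGaloisData.pushLim (⟨φ.homPi, Φ, hΦs⟩ : EquivariantMorphism D₁.Pi (C₁.K)ˣ D₂.Pi (C₂.K)ˣ)
        ((D₁.unitKummerTheoryTCG C₁).coh.toGrp ((D₁.unitKummerTheoryTCG C₁).kummerLim m)) := by
  have hm₁ : ∀ h : D₁.tcgStabilizerOpen C₁ m, (h : D₁.tcgPair.Pi) • m = m :=
    fun h => MulAction.mem_stabilizer_iff.mp h.2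
  have hm₂ : ∀ h : D₂.tcgStabilizerOpen C₂ (φ.homM m), (h : D₂.tcgPair.Pi) • φ.homM m = φ.homM m :=
    fun h => MulAction.mem_stabilizer_iff.mp h.2
  rw [D₂.unitKummerTheoryTCG_toGrp_kummerLim C₂ (φ.homM m) _ hm₂, D₁.unitKummerTheoryTCG_toGrp_kummerLim C₁ m _ hm₁,
    ModelMLFGaloisData.unitKummerTheoryTCG_kummer, ModelMLFGaloisData.unitKummerTheoryTCG_kummer]
  refine ModelMLFGaloisData.pullLim_kummerClass _ _ _ _ _ _ ?_
  change Φ (ModelMLFGaloisData.tcgToUnit C₁ m) = ModelMLFGaloisData.tcgToUnit C₂ (φ.homM m)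
  exact hΦ m

end GaloisMonoidPair.Hom

end Literature.AnabelianGeometry.AbsoluteAnabelian

end
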